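import Literature.NumberTheory.Transcendental.MZVWordShuffle
import Literature.NumberTheory.Transcendental.MultipleZetaStuffle
import Literature.NumberTheory.Transcendental.SemialgebraicMapsProofs
import HarnessLib
import Mathlib.MeasureTheory.Integral.Bochner.ContinuousLinearMap
import Mathlib.Analysis.SpecialFunctions.Integrability.Basic
import Mathlib.Data.Finsupp.Basic

/-!
# Level-4 (cyclotomic, `N = 4`) simplex representations and their word combinatorics

Definition file (Literature, `NumberTheory/Transcendental`), request `defn-levelFourRep` of route
`KontsevichZagierPeriods/OctahedralSymmetry` (needed to type `OctahedralSpanAllWeights`, the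
generic quarter-disc face family and the general level-4 stuffle); pattern of
`MZVSimplexRep.lean` one storey up (`ℙ¹ ∖ {0, ∞, ±1, ±i}` instead of `ℙ¹ ∖ {0, 1, ∞}`).

A level-4 multiple polylogarithm value (MPV)
`Li_{s₁,…,s_ℓ}(x₁,…,x_ℓ) = ∑_{n₁ > ⋯ > n_ℓ ≥ 1} ∏ⱼ xⱼ^{nⱼ} / nⱼ^{sⱼ}`, `xⱼ ∈ μ₄ = {1, i, -1, -i}`,
is an iterated integral on `[0, 1]` (Zagier's decreasing convention, as for `multipleZeta`):
`Li_s(x) = (-1)^ℓ I(0^{s₁-1} a₁ ⋯ 0^{s_ℓ-1} a_ℓ)`, `aⱼ = (x₁ ⋯ xⱼ)⁻¹`, where for a word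
`W = (w₀, …, w_{n-1})` of poles `I(W) = ∫_{1 > t₀ > ⋯ > t_{n-1} > 0} ∏ⱼ dtⱼ / (tⱼ - wⱼ)`
(Zhao 2010, §1 eqs. (1)–(2), §2; Racinet 2002, §2; first letter OUTERMOST, `t₀` near `1`).
Real and imaginary parts of `∏ⱼ (tⱼ - wⱼ)⁻¹` are rational functions with rational coefficients, so
`Re I(W)`, `Im I(W)` are values of RATIONAL simplex representations — literal KZ data.

## Contents

### Letters and words (`namespace LevelFour`, pure combinatorics, all maps compute by `decide`)

* Letters are `Fin 5`: `m ≤ 3` is the POLE `i^m` (the complex form `dt/(t - i^m)`), `4` is the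
  pole `0` (the form `dt/t`). Words `List (Fin 5)` are read outer → inner.
  `LevelFour.IsConvergent W` (first letter `≠ 0`, i.e. not the pole `1`; last letter `≠ 4`).
* Indices `List (ℕ × Fin 4)`: `(sⱼ, eⱼ)` stands for `xⱼ = i^{eⱼ}`; `LevelFour.word k` is its
  word (block `j` = `4^{sⱼ-1}` then the pole `aⱼ = i^{-(e₁+⋯+eⱼ)}`), `LevelFour.IsConvergentIdx`
  (`(s₁, x₁) ≠ (1, 1)`, all `sⱼ ≥ 1`), `LevelFour.polylogTrunc k N` the nested partial sum
  `∑_{N > n₁ > ⋯ > n_ℓ ≥ 1}` of the MPV series.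
* Formal `ℤ`-combinations of words are `List (Fin 5) →₀ ℤ` (`LevelFour.ofTerms` converts a
  computable term list `List (ℤ × List (Fin 5))`). The relation-generating maps of the route:
  `LevelFour.shuffle u v` (from `MZV.shuffleWord`); `LevelFour.stuffleIdx`/`LevelFour.stuffle`
  (the level-4 harmonic product: Hoffman's quasi-shuffle on `(s, e)`-letters with merging
  `(a, e) ⋄ (b, f) = (a + b, e + f)`, Zhao 2010 Def. 2.4 written on individual exponents);
  `LevelFour.expand φ` (multilinear expansion of a word under a letter substitution) and the
  tables `sigmaLetter` (Zhao's involution `σ(t) = (1-t)/(1+t)`: `σ^*ω_a = ω_{σ a} - ω_{-1}`,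
  `σ^*ω_{-1} = -ω_{-1}`), `dilLetter` (`t ↦ t²`), `arcLetter` (the arc `ρ(u) = (i-u)/(i+u)` from
  `1` to `i`: `ρ^*ω_a = ω_{iσa} - ω_{-i}`, `ρ^*ω_{-1} = -ω_{-i}`), `rotLetter` (`z = iu`:
  `ω_a ↦ ω_{-ia}`), `conjLetter`; and `sigmaSubst` (expand, reverse, sign `(-1)^{|W|}`, so that
  `I(W) = I(sigmaSubst W)`), `dilSubst`, `arcSubst`, `rotSubst`, `conjSubst`.

### Representations (`namespace KZ`)

* `KZ.levelFourRe`, `KZ.levelFourIm : Fin 5 → ℝ → ℝ` — the real/imaginary-part tables of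
  `1/(t - pole)` (LITERALLY the tables of the route's `ZhaoRelationInKZ`/`LevelFourStuffleInKZ`);
  `KZ.levelFourFactor m t = re + i·im = (t - pole m)⁻¹` (`KZ.levelFourFactor_eq`, PROVED).
* `KZ.levelFourProd L t = ∏ⱼ levelFourFactor (L j) (t j)` for a tuple of letters `L : Fin n → Fin 5`,
  `KZ.levelFourIntegrandC W = levelFourProd W.get`, `KZ.levelFourIntegrandRe/Im W` its parts.
* PROVED: the parts are `ℚ`-semialgebraic functions on `KZ.openOrderedSimplex n`
  (`isSemialgebraicFunOn_levelFourIntegrandRe/Im`, via BCR Prop. 2.2.6 = the tree's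
  `IsSemialgebraicFunOn.add/mul_holds`); measurable; and ABSOLUTELY INTEGRABLE on the open simplex
  for convergent words (`integrableOn_levelFourIntegrandC`, domination by
  `∏ (1 - tⱼ)^{-c} tⱼ^{-c}`, `c = 1 - 1/n`, exactly as `KZ.mzvIntegrand_integrableOn_holds`;
  generic form `integrableOn_openOrderedSimplex_of_norm_le`).
* `KZ.levelFourRepRe/Im W hconv : KZ.IntegralRep W.length` — the two rational simplex
  representations of `Re I(W)`, `Im I(W)`; the single analytic hypothesis
  `hconv : IntegrableOn (levelFourIntegrandC W) (openOrderedSimplex W.length)` is supplied by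
  `integrableOn_levelFourIntegrandC hW` for convergent `W`. PROVED API: `_domain`, `_integrand`,
  `levelFourRepRe_value = (∫ levelFourIntegrandC).re`, `…Im_value`, `integral_levelFourIntegrandC_eq`.
* Named fact `KZ.levelFourRep_value` (Zhao 2010, §1 (1)–(2), §2): for a convergent index the
  nested partial sums converge to `(-1)^ℓ ∫_Δ levelFourIntegrandC (word k)`.

## Conventions check

All tables were validated numerically at weight `≤ 2` (pure-python tanh–sinh, folder
`numerics/check_conventions.py` of the filing session): value fact (partial sums `N = 2·10⁵`,
worst `3·10⁻⁵`, conditional convergence), `I(W) = I(sigmaSubst W)` (`5·10⁻¹⁵`),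
`I(W) = I(dilSubst W)` on level-2 words (`6·10⁻¹⁵`), the level-4 stuffle against products of MPVs
(`2·10⁻¹⁵`), and the path composition `∫_{[0,i]} W = ∑ₖ I(arcSubst W[:k]) · I(W[k:])`
(`= I(rotWord W)`; first letters on the LATER arc; `10⁻¹⁴`), which with `W = (0, -1) = [4, 2]`
is exactly the three-term identity `QuarterDiscFaceWeightTwo` of the route.

## Not here

The analytic meaning of the substitution maps (change of variables on the simplex, Stokes) and
all `KZ.relations` memberships — these are the route's items; the motivic dimension bound
`d(w, 4) ≤ 2^w` (Deligne–Goncharov 2005, Deligne 2010); regularised (divergent) words.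

## References

* J. Zhao, *Standard relations of multiple polylogarithm values at roots of unity*, Doc. Math. 15
  (2010) 1–34, arXiv:0707.1459: §1 eqs. (1)–(2) (series, iterated integral, `aⱼ = 1/(x₁⋯xⱼ)`,
  convergence iff `(s₁, x₁) ≠ (1, 1)`), §2 (words `y_{s,i} = a^{s-1} b_i`, shuffle, Def. 2.4
  stuffle, FDS). [Zhao2010]
* J. Zhao, *Multiple polylogarithm values at roots of unity*, C. R. Acad. Sci. Paris 346 (2008),
  arXiv:0810.1064, §4 (octahedral symmetry of `ℙ¹ ∖ {0, ∞, μ₄}`: the involution `σ`, the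
  3-cycle `ρ`). [Zhao2008]
* G. Racinet, *Doubles mélanges des polylogarithmes multiples aux racines de l'unité*, Publ. IHÉS
  95 (2002), §2. [Racinet2002]
* M. Kontsevich, D. Zagier, *Periods* (2001), §1.1. [KontsevichZagier2001]
* M. E. Hoffman, *The algebra of multiple harmonic series*, J. Algebra 194 (1997), §2. [Hoffman1997]
-/

noncomputable section

open MeasureTheory Set Filter Complex MvPolynomial

namespace Literature.NumberTheory.Transcendental

/-! ## Part I. Letters, words, indices and the finite combinatorics -/

namespace LevelFour

/-! ### Letters

A letter is an element of `Fin 5`: `m ∈ {0, 1, 2, 3}` is the pole `i^m ∈ {1, i, -1, -i}`, i.e. the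
form `ω_{i^m} = dt/(t - i^m)`, and `4` is the pole `0`, the form `ω₀ = dt/t`. -/

/-- Complex conjugation of letters: the pole `i^m` goes to `i^{-m}` (`1 ↔ 3`), `0`, `±1` fixed;
`I(conjWord W) = conj I(W)`. [Zhao 2010, §1] [folklore] -/
def conjLetter : Fin 5 → Fin 5 := ![0, 3, 2, 1, 4]

/-- Conjugate word (letterwise `conjLetter`). [folklore] -/
def conjWord (W : List (Fin 5)) : List (Fin 5) := W.map conjLetter

/-- Rotation of letters `a ↦ -i·a` (`i^m ↦ i^{m+3}`, `0 ↦ 0`): under `z = i u` one has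
`dz/(z - a) = du/(u - (-i a))`, so the iterated integral of `W` along the segment `[0, i]` is
`I(rotWord W)`. [Zhao 2008, §4] [folklore] -/
def rotLetter : Fin 5 → Fin 5 := ![3, 0, 1, 2, 4]

/-- Rotated word (letterwise `rotLetter`). [folklore] -/
def rotWord (W : List (Fin 5)) : List (Fin 5) := W.map rotLetter

/-- A word is **convergent** if its first (outermost, `t₀` near `1`) letter is not the pole `1`
and its last (innermost, near `0`) letter is not the pole `0` (Zhao's admissible words "not
beginning with `b₀` and not ending with `a`"); the iterated integral of such a word over
`1 > t₀ > ⋯ > 0` converges absolutely (`KZ.integrableOn_levelFourIntegrandC` below). The empty word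
is convergent. [cite: Zhao2010, §2 Def. 2.1] -/
def IsConvergent (W : List (Fin 5)) : Prop := W.head? ≠ some 0 ∧ W.getLast? ≠ some 4

/-- `IsConvergent` is decidable (it is a statement about `head?`/`getLast?`). [folklore] -/
instance (W : List (Fin 5)) : Decidable (IsConvergent W) := by
  unfold IsConvergent; infer_instance

/-! ### Indices and their words -/

/-- An index `((s₁, e₁), …, (s_ℓ, e_ℓ))` (meaning `Li_{s₁,…,s_ℓ}(i^{e₁}, …, i^{e_ℓ})`) is
**convergent** if all `sⱼ ≥ 1` and `(s₁, x₁) ≠ (1, 1)`, i.e. `(s₁, e₁) ≠ (1, 0)` — the convergence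
criterion of the MPV series. [cite: Zhao2010, §1] -/
def IsConvergentIdx (k : List (ℕ × Fin 4)) : Prop :=
  (∀ p ∈ k, 1 ≤ p.1) ∧ ∀ p ∈ k.head?, p ≠ (1, 0)

/-- `IsConvergentIdx` is decidable. [folklore] -/
instance (k : List (ℕ × Fin 4)) : Decidable (IsConvergentIdx k) := by
  unfold IsConvergentIdx; infer_instance

/-- Auxiliary for `LevelFour.word`: the word of an index read with accumulated exponent `acc`
(`= e₁ + ⋯ + e_{j-1}` in front of block `j`); block `j` is `4^{sⱼ - 1}` (the forms `dt/t`) followed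
by the pole `aⱼ = i^{-(acc + eⱼ)}` (Zhao's `y_{s,i} = a^{s-1} b_i` with cumulative `i`).
[cite: Zhao2010, §2] -/
def wordAux : Fin 4 → List (ℕ × Fin 4) → List (Fin 5)
  | _, [] => []
  | acc, p :: k =>
      List.replicate (p.1 - 1) 4 ++ [Fin.castSucc (-(acc + p.2))] ++ wordAux (acc + p.2) k

/-- **The word of an index**: `word ((s₁,e₁),…,(s_ℓ,e_ℓ)) = 0^{s₁-1} a₁ ⋯ 0^{s_ℓ-1} a_ℓ` (outer →
inner) with poles `aⱼ = (x₁⋯xⱼ)⁻¹ = i^{-(e₁+⋯+eⱼ)}`, `xⱼ = i^{eⱼ}`; so that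
`Li_s(x) = (-1)^ℓ I(word k)` (Zhao 2010, §1 eq. (2); §2: `L_N(s | i) = ∫₀¹ y_{s₁,i₁} y_{s₂,i₁+i₂} ⋯`
with `b_i = -ω_{μ^{-i}}`). E.g. `word [(1,1),(2,1)] = [3, 4, 2]` (`Li_{1,2}(i, i)`: poles `-i`,
`0`, `-1`). [cite: Zhao2010, §1 eq. (2)] -/
def word (k : List (ℕ × Fin 4)) : List (Fin 5) := wordAux 0 k

/-- The general term `∏ⱼ xⱼ^{nⱼ} / nⱼ^{sⱼ}`, `xⱼ = i^{eⱼ}`, of the MPV series of the index `k`.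
[cite: Zhao2010, §1 eq. (1)] -/
def polylogTerm (k : List (ℕ × Fin 4)) (n : Fin k.length → ℕ) : ℂ :=
  ∏ j, (I ^ ((k.get j).2 : ℕ)) ^ (n j) / (n j : ℂ) ^ (k.get j).1

/-- The nested partial sum `∑_{N > n₁ > ⋯ > n_ℓ ≥ 1} ∏ⱼ xⱼ^{nⱼ} / nⱼ^{sⱼ}` of the level-4 MPV
series `Li_{s₁,…,s_ℓ}(i^{e₁}, …, i^{e_ℓ})` (summation domain `MZV.truncSet`, Zagier's decreasing
convention as in `multipleZeta`; the series converges, conditionally when `s₁ = 1`, iff the index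
is convergent). [cite: Zhao2010, §1 eq. (1)] -/
def polylogTrunc (k : List (ℕ × Fin 4)) (N : ℕ) : ℂ :=
  ∑ n ∈ MZV.truncSet k.length N, polylogTerm k n

/-! ### Formal `ℤ`-combinations of words -/

/-- The formal `ℤ`-combination of words `∑ (c, V) ↦ c • [V]` attached to a (computable) list of
terms. [folklore] -/
def ofTerms (L : List (ℤ × List (Fin 5))) : List (Fin 5) →₀ ℤ :=
  (L.map fun p => Finsupp.single p.2 p.1).sum

/-- `ofTerms [] = 0`. [folklore] -/
@[simp] theorem ofTerms_nil : ofTerms [] = 0 := rfl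

/-- `ofTerms ((c, V) :: L) = c • [V] + ofTerms L`. [folklore] -/
@[simp] theorem ofTerms_cons (p : ℤ × List (Fin 5)) (L : List (ℤ × List (Fin 5))) :
    ofTerms (p :: L) = Finsupp.single p.2 p.1 + ofTerms L := by
  simp [ofTerms]

/-- `ofTerms` is additive under concatenation. [folklore] -/
theorem ofTerms_append (L L' : List (ℤ × List (Fin 5))) :
    ofTerms (L ++ L') = ofTerms L + ofTerms L' := by
  simp [ofTerms, List.sum_append]

/-! ### Shuffle and level-4 stuffle -/

/-- The **shuffle product** `u ш v` of two words as a formal `ℤ`-combination of words (all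
interleavings with multiplicity, `MZV.shuffleWord`); for convergent words
`I(u) I(v) = ∑_{w ∈ u ш v} I(w)` (product of two simplices; Chen's lemma).
[cite: Zhao2010, §2 Lemma 2.2] -/
def shuffle (u v : List (Fin 5)) : List (Fin 5) →₀ ℤ :=
  ofTerms ((MZV.shuffleWord u v).map fun w => ((1 : ℤ), w))

/-- Inner recursion of the level-4 stuffle on the second index (first index `p :: k` fixed, with
`stK = stuffleIdx k`), so that both recursions are structural and `stuffleIdx` computes by
`decide`. Auxiliary to `LevelFour.stuffleIdx`. [folklore] -/
def stuffleIdxAux (p : ℕ × Fin 4) (stK : List (ℕ × Fin 4) → List (List (ℕ × Fin 4)))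
    (pk : List (ℕ × Fin 4)) : List (ℕ × Fin 4) → List (List (ℕ × Fin 4))
  | [] => [pk]
  | q :: l => (stK (q :: l)).map (List.cons p) ++
      ((stuffleIdxAux p stK pk l).map (List.cons q) ++
        (stK l).map (List.cons (p.1 + q.1, p.2 + q.2)))

/-- The **level-4 stuffle (harmonic product) of indices**, as the list with multiplicity of the
indices in `k ∗ l`: Hoffman's quasi-shuffle recursion
`(a,e)k' ∗ (b,f)l' = (a,e)(k' ∗ (b,f)l') + (b,f)((a,e)k' ∗ l') + (a+b, e+f)(k' ∗ l')` on the letters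
`(s, e)` (`x = i^e`; merging multiplies the roots of unity), i.e. Zhao's stuffle (Def. 2.4, there
written with cumulative exponents and shifts `τ`) on individual exponents; for convergent indices
`Li(k) Li(l) = ∑_{m ∈ k ∗ l} Li(m)` (series multiplication). [cite: Zhao2010, Def. 2.4] -/
def stuffleIdx : List (ℕ × Fin 4) → List (ℕ × Fin 4) → List (List (ℕ × Fin 4))
  | [], l => [l]
  | p :: k, l => stuffleIdxAux p (stuffleIdx k) (p :: k) l

/-- `[] ∗ l = l`. [folklore] -/
@[simp] theorem stuffleIdx_nil_left (l : List (ℕ × Fin 4)) : stuffleIdx [] l = [l] := rfl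

/-- `k ∗ [] = k`. [folklore] -/
@[simp] theorem stuffleIdx_nil_right (k : List (ℕ × Fin 4)) : stuffleIdx k [] = [k] := by
  cases k <;> rfl

/-- The quasi-shuffle recursion `pk ∗ ql = p(k ∗ ql) + q(pk ∗ l) + (p ⋄ q)(k ∗ l)`,
`(a, e) ⋄ (b, f) = (a + b, e + f)`. [cite: Zhao2010, Def. 2.4] -/
@[simp] theorem stuffleIdx_cons_cons (p q : ℕ × Fin 4) (k l : List (ℕ × Fin 4)) :
    stuffleIdx (p :: k) (q :: l) =
      (stuffleIdx k (q :: l)).map (List.cons p) ++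
        ((stuffleIdx (p :: k) l).map (List.cons q) ++
          (stuffleIdx k l).map (List.cons (p.1 + q.1, p.2 + q.2))) :=
  rfl

/-- The **level-4 stuffle as words**: `∑_{m ∈ k ∗ l} [word m]`; the finite double shuffle
relations of the route are `stuffle k l - shuffle (word k) (word l)`.
[cite: Zhao2010, §2 (FDS)] -/
def stuffle (k l : List (ℕ × Fin 4)) : List (Fin 5) →₀ ℤ :=
  ofTerms ((stuffleIdx k l).map fun m => ((1 : ℤ), word m))

/-! ### Letter substitutions -/

/-- **Multilinear expansion** of a word under a letter substitution `φ` (each letter `m` replaced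
by the formal combination `∑ (c, b) ∈ φ m, c • b`): the list of terms
`(∏ⱼ cⱼ, (b₀, …, b_{n-1}))` over all choices, in lexicographic order. [folklore] -/
def expand (φ : Fin 5 → List (ℤ × Fin 5)) : List (Fin 5) → List (ℤ × List (Fin 5))
  | [] => [(1, [])]
  | m :: W => (φ m).flatMap fun cb => (expand φ W).map fun dV => (cb.1 * dV.1, cb.2 :: dV.2)

/-- `expand φ [] = [(1, [])]`. [folklore] -/
@[simp] theorem expand_nil (φ : Fin 5 → List (ℤ × Fin 5)) : expand φ [] = [(1, [])] := rfl

/-- The recursion of `expand`. [folklore] -/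
@[simp] theorem expand_cons (φ : Fin 5 → List (ℤ × Fin 5)) (m : Fin 5) (W : List (Fin 5)) :
    expand φ (m :: W) =
      (φ m).flatMap fun cb => (expand φ W).map fun dV => (cb.1 * dV.1, cb.2 :: dV.2) := rfl

/-- **Zhao's octahedral involution** `σ(t) = (1 - t)/(1 + t)` of `[0, 1]` (`0 ↔ 1`, `i ↔ -i`,
`-1 ↔ ∞`) on letters: `σ^*ω_a = ω_{σ(a)} - ω_{-1}` for `a ≠ -1` (`σ(1) = 0`, `σ(i) = -i`,
`σ(-i) = i`, `σ(0) = 1`) and `σ^*ω_{-1} = -ω_{-1}` (partial fractions of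
`dσ/(σ - a) = -2 dt / ((1+t)((1-a) - (1+a)t))`). Table by letter: `0 ↦ [4] - [2]`, `1 ↦ [3] - [2]`,
`2 ↦ -[2]`, `3 ↦ [1] - [2]`, `4 ↦ [0] - [2]`. [cite: Zhao2008, §4] -/
def sigmaLetter : Fin 5 → List (ℤ × Fin 5) :=
  ![[(1, 4), (-1, 2)], [(1, 3), (-1, 2)], [(-1, 2)], [(1, 1), (-1, 2)], [(1, 0), (-1, 2)]]

/-- **The squaring map** `t ↦ t²` (distribution / dilation) on LEVEL-2 letters:
`d(t²)/(t² - b) = 2t dt/(t² - b)`, so `ω₀ ↦ 2ω₀`, `ω₁ ↦ ω₁ + ω_{-1}`, `ω_{-1} ↦ ω_i + ω_{-i}`; the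
letters `1`, `3` (poles `±i`, whose square roots have level 8) are sent to the EMPTY combination
(junk: `dilSubst` kills words containing them). Table: `0 ↦ [0] + [2]`, `2 ↦ [1] + [3]`,
`4 ↦ 2[4]`, `1, 3 ↦ 0`. [cite: Zhao2010, §5] -/
def dilLetter : Fin 5 → List (ℤ × Fin 5) :=
  ![[(1, 0), (1, 2)], [], [(1, 1), (1, 3)], [], [(2, 4)]]

/-- **The quarter arc** `ρ(u) = (i - u)/(i + u)` from `ρ(0) = 1` to `ρ(1) = i` on the unit circle
(Zhao's 3-cycle of the octahedral group) on letters: `ρ^*ω_a = ω_{iσ(a)} - ω_{-i}` for `a ≠ -1`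
(`iσ(1) = 0`, `iσ(i) = 1`, `iσ(-i) = -1`, `iσ(0) = i`) and `ρ^*ω_{-1} = -ω_{-i}`. Table:
`0 ↦ [4] - [3]`, `1 ↦ [0] - [3]`, `2 ↦ -[3]`, `3 ↦ [2] - [3]`, `4 ↦ [1] - [3]`. (The quarter-disc face
identities use `e₁`-free words: the pole `1` is the starting point of the arc.)
[cite: Zhao2008, §4] -/
def arcLetter : Fin 5 → List (ℤ × Fin 5) :=
  ![[(1, 4), (-1, 3)], [(1, 0), (-1, 3)], [(-1, 3)], [(1, 2), (-1, 3)], [(1, 1), (-1, 3)]]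

/-- **`sigmaSubst W`**: the change of variables `tⱼ = σ(uⱼ)` in `I(W)` — expand every letter by
`sigmaLetter`, REVERSE the words (`σ` is decreasing, so `1 > t₀ > ⋯ > t_{n-1} > 0` becomes
`0 < u₀ < ⋯ < u_{n-1} < 1`) and multiply by `(-1)^{|W|}` (from `|σ'| = -σ'`); then
`I(W) = ∑ c_V I(V)` over `sigmaSubst W = ∑ c_V [V]`, equivalently `I(σ^*W) = (-1)^{|W|} I(reverse W)`,
for every convergent `W` (all `V` are then convergent). The family (inv) of the route.
[cite: Zhao2008, §4] -/
def sigmaSubst (W : List (Fin 5)) : List (Fin 5) →₀ ℤ :=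
  (-1 : ℤ) ^ W.length • ofTerms ((expand sigmaLetter W).map fun cV => (cV.1, cV.2.reverse))

/-- **`dilSubst W`**: the order-preserving change of variables `tⱼ = uⱼ²` in `I(W)` for a level-2
word `W` (letters in `{0, 2, 4}`): `I(W) = ∑ c_V I(V)` over `dilSubst W` — the distribution
relations level 2 → level 4. Words with a letter `1` or `3` are sent to `0` (junk).
[cite: Zhao2010, §5] -/
def dilSubst (W : List (Fin 5)) : List (Fin 5) →₀ ℤ := ofTerms (expand dilLetter W)

/-- **`arcSubst W`**: the pull-back of the word `W` along the arc `ρ : [0,1] → {|z| = 1}` from `1`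
to `i` (orientation preserved, no reversal): the iterated integral of `W` along the arc equals
`∑ c_V I(V)` over `arcSubst W`. With `rotWord` and path composition
(`∫_{[0,i]} W = ∑ₖ I(arcSubst (W.take k)) · I(W.drop k)`, first letters on the later path) this
writes the quarter-disc face (prism–Stokes) identities of the route. [cite: Zhao2008, §4] -/
def arcSubst (W : List (Fin 5)) : List (Fin 5) →₀ ℤ := ofTerms (expand arcLetter W)

/-- **`rotSubst W = [rotWord W]`**: the segment `[0, i]` pulled back to `[0, 1]` by `z = iu`.
[cite: Zhao2008, §4] -/
def rotSubst (W : List (Fin 5)) : List (Fin 5) →₀ ℤ := Finsupp.single (rotWord W) 1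

/-- **`conjSubst W = [conjWord W]`**: complex conjugation (`Re I(W̄) = Re I(W)`,
`Im I(W̄) = -Im I(W)`; the family (conj) of the route). [folklore] -/
def conjSubst (W : List (Fin 5)) : List (Fin 5) →₀ ℤ := Finsupp.single (conjWord W) 1

/-! ### Computed examples (the maps are executable specifications) -/

/-- `Li_{1,1}(i, -1)`: poles `a₁ = -i`, `a₂ = (i·(-1))⁻¹ = i`; `Li_{1,2}(i, i)`: word `(-i, 0, -1)`;
`ζ(2) = Li₂(1)`: word `(0, 1)`. [cite: Zhao2010, §2] -/
example : word [(1, 1), (1, 2)] = [3, 1] ∧ word [(1, 1), (2, 1)] = [3, 4, 2] ∧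
    word [(2, 0)] = [4, 0] := by decide

/-- `Li_{1,2}(i, i)` is convergent, `Li_{1,2}(1, i)` is not. [cite: Zhao2010, §1] -/
example : IsConvergent (word [(1, 1), (2, 1)]) ∧ ¬ IsConvergent (word [(1, 0), (2, 1)]) := by
  decide

/-- `(1, i) ∗ (2, -i) = (1,i)(2,-i) + (2,-i)(1,i) + (3, 1)`, i.e.
`Li₁(i) Li₂(-i) = Li_{1,2}(i,-i) + Li_{2,1}(-i,i) + Li₃(1)`. [cite: Zhao2010, Def. 2.4] -/
example : stuffleIdx [(1, 1)] [(2, 3)] = [[(1, 1), (2, 3)], [(2, 3), (1, 1)], [(3, 0)]] := by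
  decide

/-- `σ^*ω_i = ω_{-i} - ω_{-1}`; `σ^*(ω_{-1}ω_{-1}) = ω_{-1}ω_{-1}`; `(t ↦ t²)^*(ω₀ ω₁) =
2 ω₀ω₁ + 2 ω₀ω_{-1}`. [cite: Zhao2008, §4] -/
example : expand sigmaLetter [1] = [(1, [3]), (-1, [2])] ∧ expand sigmaLetter [2, 2] = [(1, [2, 2])] ∧
    expand dilLetter [4, 0] = [(2, [4, 0]), (2, [4, 2])] := by decide

/-- The rotation and conjugation tables. [folklore] -/
example : rotWord [0, 1, 2, 3, 4] = [3, 0, 1, 2, 4] ∧ conjWord [0, 1, 2, 3, 4] = [0, 3, 2, 1, 4] := by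
  decide

/-! ### Elementary API of words of indices -/

/-- The word of an index with all `sⱼ ≥ 1`, read with any accumulated exponent, has length the
weight `∑ sⱼ`. [folklore] -/
theorem length_wordAux (acc : Fin 4) (k : List (ℕ × Fin 4)) (hk : ∀ p ∈ k, 1 ≤ p.1) :
    (wordAux acc k).length = (k.map Prod.fst).sum := by
  induction k generalizing acc with
  | nil => rfl
  | cons p k ih =>
    have hp : 1 ≤ p.1 := hk p (by simp)
    have := ih (acc + p.2) fun q hq => hk q (by simp [hq])
    simp only [wordAux, List.length_append, List.length_replicate, List.length_singleton, this,
      List.map_cons, List.sum_cons]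
    omega

/-- **The word of an index has length the weight** `s₁ + ⋯ + s_ℓ` (all `sⱼ ≥ 1`). [folklore] -/
theorem length_word (k : List (ℕ × Fin 4)) (hk : ∀ p ∈ k, 1 ≤ p.1) :
    (word k).length = (k.map Prod.fst).sum :=
  length_wordAux 0 k hk

/-- The word of a nonempty index is nonempty. [folklore] -/
theorem wordAux_ne_nil (acc : Fin 4) {k : List (ℕ × Fin 4)} (hk : k ≠ []) :
    wordAux acc k ≠ [] := by
  cases k with
  | nil => exact (hk rfl).elim
  | cons p k => simp [wordAux]

/-- The last letter of the word of a nonempty index is a pole `i^x` (never the pole `0`).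
[folklore] -/
theorem getLast?_wordAux (acc : Fin 4) {k : List (ℕ × Fin 4)} (hk : k ≠ []) :
    ∃ x : Fin 4, (wordAux acc k).getLast? = some (Fin.castSucc x) := by
  induction k generalizing acc with
  | nil => exact (hk rfl).elim
  | cons p k ih =>
    by_cases h : k = []
    · subst h
      exact ⟨-(acc + p.2), by simp [wordAux]⟩
    · obtain ⟨x, hx⟩ := ih (acc + p.2) h
      refine ⟨x, ?_⟩
      rw [wordAux, List.getLast?_append, hx]
      rfl

/-- The first letter of the word of `(s, e) :: k` is the pole `i^{-(acc+e)}` if `s ≤ 1` and the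
pole `0` (letter `4`) if `s ≥ 2`. [folklore] -/
theorem head?_wordAux (acc : Fin 4) (p : ℕ × Fin 4) (k : List (ℕ × Fin 4)) :
    (wordAux acc (p :: k)).head? = some (if p.1 ≤ 1 then Fin.castSucc (-(acc + p.2)) else 4) := by
  rw [wordAux]
  rcases Nat.lt_or_ge 1 p.1 with h | h
  · obtain ⟨m, hm⟩ : ∃ m, p.1 - 1 = m + 1 := ⟨p.1 - 2, by omega⟩
    rw [hm, List.replicate_succ, if_neg (by omega)]
    rfl
  · rw [show p.1 - 1 = 0 by omega, List.replicate_zero, if_pos h]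
    rfl

/-- **The word of a convergent index is a convergent word** (`(s₁, x₁) ≠ (1, 1)` makes the first
letter `≠` pole `1`; the last letter is always a pole `i^x`). [cite: Zhao2010, §2] -/
theorem isConvergent_word {k : List (ℕ × Fin 4)} (hk : IsConvergentIdx k) :
    IsConvergent (word k) := by
  cases k with
  | nil => decide
  | cons p k =>
    obtain ⟨hpos, hhead⟩ := hk
    have hp1 : 1 ≤ p.1 := hpos p (by simp)
    have hp : p ≠ (1, 0) := hhead p (by simp)
    constructor
    · rw [word, head?_wordAux]
      split_ifs with h
      · have hs : p.1 = 1 := le_antisymm h hp1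
        have he : p.2 ≠ 0 := fun he => hp (Prod.ext hs he)
        revert he
        generalize p.2 = e
        intro he
        fin_cases e <;> simp_all
      · decide
    · obtain ⟨x, hx⟩ := getLast?_wordAux 0 (List.cons_ne_nil p k)
      rw [word, hx]
      intro h
      simp only [Option.some.injEq] at h
      exact absurd (congrArg Fin.val h) (by have := x.isLt; simp; omega)

/-- **Shuffles of convergent words are convergent** (an interleaving begins with the first letter
of `u` or `v` and ends with the last letter of `u` or `v`). [folklore] -/
theorem isConvergent_of_mem_shuffleWord {u v w : List (Fin 5)} (hu : IsConvergent u)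
    (hv : IsConvergent v) (hw : w ∈ MZV.shuffleWord u v) : IsConvergent w := by
  constructor
  · rcases MZV.head?_of_mem_shuffleWord u v hw with h | h
    · rw [h]; exact hu.1
    · rw [h]; exact hv.1
  · rcases MZV.getLast?_of_mem_shuffleWord u v hw with h | h
    · rw [h]; exact hu.2
    · rw [h]; exact hv.2

end LevelFour

/-! ## Part II. The rational simplex representations -/

namespace KZ

/-! ### Letter tables -/

/-- The poles of the five letters: `m ≤ 3 ↦ i^m`, `4 ↦ 0`. [cite: Zhao2010, §2] -/
def levelFourPole : Fin 5 → ℂ := ![1, I, -1, -I, 0]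

/-- **Real parts of the letters** `1/(t - pole)` for real `t`:
`1/(t-1)`, `t/(1+t²)`, `1/(1+t)`, `t/(1+t²)`, `1/t` — literally the table `re` of the route's
`ZhaoRelationInKZ` / `LevelFourStuffleInKZ`. (Junk value `1/0 = 0` at `t = 1`, letter `0`, and at
`t = 0`, letter `4`, off the open simplex.) [cite: Zhao2010, §2] -/
def levelFourRe : Fin 5 → ℝ → ℝ :=
  ![fun t => 1 / (t - 1), fun t => t / (1 + t ^ 2), fun t => 1 / (1 + t), fun t => t / (1 + t ^ 2),
    fun t => 1 / t]

/-- **Imaginary parts of the letters** `1/(t - pole)` for real `t`: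
`0`, `1/(1+t²)`, `0`, `-1/(1+t²)`, `0` — literally the table `im` of the route.
[cite: Zhao2010, §2] -/
def levelFourIm : Fin 5 → ℝ → ℝ :=
  ![fun _ => 0, fun t => 1 / (1 + t ^ 2), fun _ => 0, fun t => -1 / (1 + t ^ 2), fun _ => 0]

/-- The complex letter `re_m(t) + i·im_m(t)` (`= 1/(t - pole m)`, `levelFourFactor_eq`).
[cite: Zhao2010, §2] -/
def levelFourFactor (m : Fin 5) (t : ℝ) : ℂ :=
  (levelFourRe m t : ℂ) + (levelFourIm m t : ℂ) * I

/-- The table `levelFourRe` is the route's literal `re`. [folklore] -/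
theorem levelFourRe_eq : levelFourRe = ![fun t => 1 / (t - 1), fun t => t / (1 + t ^ 2),
    fun t => 1 / (1 + t), fun t => t / (1 + t ^ 2), fun t => 1 / t] := rfl

/-- The table `levelFourIm` is the route's literal `im`. [folklore] -/
theorem levelFourIm_eq : levelFourIm = ![fun _ => 0, fun t => 1 / (1 + t ^ 2), fun _ => 0,
    fun t => -1 / (1 + t ^ 2), fun _ => 0] := rfl

/-- `re₀(t) = 1/(t-1)`. [folklore] -/
@[simp] theorem levelFourRe_zero (t : ℝ) : levelFourRe 0 t = 1 / (t - 1) := rfl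
/-- `re₁(t) = t/(1+t²)`. [folklore] -/
@[simp] theorem levelFourRe_one (t : ℝ) : levelFourRe 1 t = t / (1 + t ^ 2) := rfl
/-- `re₂(t) = 1/(1+t)`. [folklore] -/
@[simp] theorem levelFourRe_two (t : ℝ) : levelFourRe 2 t = 1 / (1 + t) := rfl
/-- `re₃(t) = t/(1+t²)`. [folklore] -/
@[simp] theorem levelFourRe_three (t : ℝ) : levelFourRe 3 t = t / (1 + t ^ 2) := rfl
/-- `re₄(t) = 1/t`. [folklore] -/
@[simp] theorem levelFourRe_four (t : ℝ) : levelFourRe 4 t = 1 / t := rfl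
/-- `im₀ = 0`. [folklore] -/
@[simp] theorem levelFourIm_zero (t : ℝ) : levelFourIm 0 t = 0 := rfl
/-- `im₁(t) = 1/(1+t²)`. [folklore] -/
@[simp] theorem levelFourIm_one (t : ℝ) : levelFourIm 1 t = 1 / (1 + t ^ 2) := rfl
/-- `im₂ = 0`. [folklore] -/
@[simp] theorem levelFourIm_two (t : ℝ) : levelFourIm 2 t = 0 := rfl
/-- `im₃(t) = -1/(1+t²)`. [folklore] -/
@[simp] theorem levelFourIm_three (t : ℝ) : levelFourIm 3 t = -1 / (1 + t ^ 2) := rfl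
/-- `im₄ = 0`. [folklore] -/
@[simp] theorem levelFourIm_four (t : ℝ) : levelFourIm 4 t = 0 := rfl

/-- `1 + t² ≠ 0` in `ℂ` for real `t`. [folklore] -/
theorem one_add_ofReal_sq_ne_zero (t : ℝ) : (1 : ℂ) + (t : ℂ) ^ 2 ≠ 0 := by
  have h : (0 : ℝ) < 1 + t ^ 2 := by positivity
  exact_mod_cast h.ne'

/-- **The letter tables are the real and imaginary parts of `1/(t - pole)`**:
`re_m(t) + i·im_m(t) = (t - pole m)⁻¹` for every real `t` (including the junk points, where both
sides are `0`). [cite: Zhao2010, §2] -/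
theorem levelFourFactor_eq (m : Fin 5) (t : ℝ) :
    levelFourFactor m t = ((t : ℂ) - levelFourPole m)⁻¹ := by
  have h2 := one_add_ofReal_sq_ne_zero t
  have hI : ((t : ℂ) - I) * ((t : ℂ) + I) = 1 + (t : ℂ) ^ 2 := by ring_nf; rw [I_sq]; ring
  have hinv1 : ((t : ℂ) - I)⁻¹ = ((t : ℂ) + I) / (1 + (t : ℂ) ^ 2) :=
    inv_eq_of_mul_eq_one_right (by rw [mul_div_assoc', hI, div_self h2])
  have hinv3 : ((t : ℂ) + I)⁻¹ = ((t : ℂ) - I) / (1 + (t : ℂ) ^ 2) :=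
    inv_eq_of_mul_eq_one_right (by rw [mul_div_assoc', mul_comm, hI, div_self h2])
  fin_cases m
  · show ((1 / (t - 1) : ℝ) : ℂ) + ((0 : ℝ) : ℂ) * I = ((t : ℂ) - 1)⁻¹
    push_cast
    simp
  · show ((t / (1 + t ^ 2) : ℝ) : ℂ) + ((1 / (1 + t ^ 2) : ℝ) : ℂ) * I = ((t : ℂ) - I)⁻¹
    rw [hinv1]
    push_cast
    rw [div_mul_eq_mul_div, one_mul, ← add_div]
  · show ((1 / (1 + t) : ℝ) : ℂ) + ((0 : ℝ) : ℂ) * I = ((t : ℂ) - -1)⁻¹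
    push_cast
    simp only [zero_mul, add_zero, sub_neg_eq_add, one_div]
    rw [add_comm]
  · show ((t / (1 + t ^ 2) : ℝ) : ℂ) + ((-1 / (1 + t ^ 2) : ℝ) : ℂ) * I = ((t : ℂ) - -I)⁻¹
    rw [sub_neg_eq_add, hinv3]
    push_cast
    rw [div_mul_eq_mul_div, ← add_div]
    ring
  · show ((1 / t : ℝ) : ℂ) + ((0 : ℝ) : ℂ) * I = ((t : ℂ) - 0)⁻¹
    push_cast
    simp

/-! ### Integrands -/

variable {n : ℕ}

/-- The complex integrand `∏ⱼ (re_{Lⱼ}(tⱼ) + i·im_{Lⱼ}(tⱼ)) = ∏ⱼ (tⱼ - pole Lⱼ)⁻¹` of a tuple of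
letters `L : Fin n → Fin 5` (tuple form, convenient for `Fin n → Fin 5` words such as the route's
`word k : Fin 3 → Fin 5`). [cite: Zhao2010, §2] -/
def levelFourProd (L : Fin n → Fin 5) (t : Fin n → ℝ) : ℂ :=
  ∏ j, levelFourFactor (L j) (t j)

/-- **The complex integrand of a word** `W` (outer → inner): `∏ⱼ (tⱼ - pole Wⱼ)⁻¹` on `ℝ^{|W|}`,
written through the real tables. [cite: Zhao2010, §1 eq. (2)] -/
def levelFourIntegrandC (W : List (Fin 5)) (t : Fin W.length → ℝ) : ℂ :=
  levelFourProd W.get t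

/-- **`levelFourIntegrandRe W`**: the real part of `∏ⱼ (re_{Wⱼ}(tⱼ) + i·im_{Wⱼ}(tⱼ))`, a rational
function of `t` with rational coefficients. [cite: Zhao2010, §1 eq. (2)] -/
def levelFourIntegrandRe (W : List (Fin 5)) (t : Fin W.length → ℝ) : ℝ :=
  (levelFourIntegrandC W t).re

/-- **`levelFourIntegrandIm W`**: the imaginary part of `∏ⱼ (re_{Wⱼ}(tⱼ) + i·im_{Wⱼ}(tⱼ))`.
[cite: Zhao2010, §1 eq. (2)] -/
def levelFourIntegrandIm (W : List (Fin 5)) (t : Fin W.length → ℝ) : ℝ :=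
  (levelFourIntegrandC W t).im

/-- The complex integrand is `∏ⱼ (tⱼ - pole Wⱼ)⁻¹`. [cite: Zhao2010, §1 eq. (2)] -/
theorem levelFourIntegrandC_eq_prod (W : List (Fin 5)) (t : Fin W.length → ℝ) :
    levelFourIntegrandC W t =
      ∏ j : Fin W.length, (((t j : ℝ) : ℂ) - levelFourPole (W.get j))⁻¹ := by
  simp only [levelFourIntegrandC, levelFourProd, levelFourFactor_eq]

/-- The tuple integrand is `∏ⱼ (tⱼ - pole Lⱼ)⁻¹`. [cite: Zhao2010, §1 eq. (2)] -/
theorem levelFourProd_eq_prod (L : Fin n → Fin 5) (t : Fin n → ℝ) :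
    levelFourProd L t = ∏ j, (((t j : ℝ) : ℂ) - levelFourPole (L j))⁻¹ := by
  simp only [levelFourProd, levelFourFactor_eq]

/-! ### Low-dimensional expansions (the shapes used by the route's weight-≤ 3 items) -/

/-- One letter: `Re (re + i·im) = re`. [folklore] -/
theorem levelFourProd_re_fin_one (L : Fin 1 → Fin 5) (t : Fin 1 → ℝ) :
    (levelFourProd L t).re = levelFourRe (L 0) (t 0) := by
  simp [levelFourProd, levelFourFactor]

/-- One letter: `Im (re + i·im) = im`. [folklore] -/
theorem levelFourProd_im_fin_one (L : Fin 1 → Fin 5) (t : Fin 1 → ℝ) :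
    (levelFourProd L t).im = levelFourIm (L 0) (t 0) := by
  simp [levelFourProd, levelFourFactor]

/-- Two letters: `Re = re₀re₁ - im₀im₁`. [folklore] -/
theorem levelFourProd_re_fin_two (L : Fin 2 → Fin 5) (t : Fin 2 → ℝ) :
    (levelFourProd L t).re =
      levelFourRe (L 0) (t 0) * levelFourRe (L 1) (t 1) -
        levelFourIm (L 0) (t 0) * levelFourIm (L 1) (t 1) := by
  simp [levelFourProd, levelFourFactor, Fin.prod_univ_two]

/-- Two letters: `Im = re₀im₁ + im₀re₁`. [folklore] -/
theorem levelFourProd_im_fin_two (L : Fin 2 → Fin 5) (t : Fin 2 → ℝ) :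
    (levelFourProd L t).im =
      levelFourRe (L 0) (t 0) * levelFourIm (L 1) (t 1) +
        levelFourIm (L 0) (t 0) * levelFourRe (L 1) (t 1) := by
  simp [levelFourProd, levelFourFactor, Fin.prod_univ_two]

/-- Three letters: `Re = re₀re₁re₂ - re₀im₁im₂ - im₀re₁im₂ - im₀im₁re₂` (the integrand shape of
the route's `ZhaoRelationInKZ`, real part). [folklore] -/
theorem levelFourProd_re_fin_three (L : Fin 3 → Fin 5) (t : Fin 3 → ℝ) :
    (levelFourProd L t).re =
      levelFourRe (L 0) (t 0) * levelFourRe (L 1) (t 1) * levelFourRe (L 2) (t 2) -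
        levelFourRe (L 0) (t 0) * levelFourIm (L 1) (t 1) * levelFourIm (L 2) (t 2) -
        levelFourIm (L 0) (t 0) * levelFourRe (L 1) (t 1) * levelFourIm (L 2) (t 2) -
        levelFourIm (L 0) (t 0) * levelFourIm (L 1) (t 1) * levelFourRe (L 2) (t 2) := by
  simp [levelFourProd, levelFourFactor, Fin.prod_univ_three]
  ring

/-- Three letters: `Im = re₀re₁im₂ + re₀im₁re₂ + im₀re₁re₂ - im₀im₁im₂` (the integrand shape of
the route's `ZhaoRelationInKZ`, imaginary part). [folklore] -/
theorem levelFourProd_im_fin_three (L : Fin 3 → Fin 5) (t : Fin 3 → ℝ) :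
    (levelFourProd L t).im =
      levelFourRe (L 0) (t 0) * levelFourRe (L 1) (t 1) * levelFourIm (L 2) (t 2) +
        levelFourRe (L 0) (t 0) * levelFourIm (L 1) (t 1) * levelFourRe (L 2) (t 2) +
        levelFourIm (L 0) (t 0) * levelFourRe (L 1) (t 1) * levelFourRe (L 2) (t 2) -
        levelFourIm (L 0) (t 0) * levelFourIm (L 1) (t 1) * levelFourIm (L 2) (t 2) := by
  simp [levelFourProd, levelFourFactor, Fin.prod_univ_three]
  ring

/-! ### Semialgebraicity (rational functions with rational coefficients) -/

/-- Each real-part letter `t ↦ re_m(tⱼ)` is a quotient of polynomials over `ℚ` whose denominator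
(`tⱼ - 1`, `1 + tⱼ²`, `1 + tⱼ`, `tⱼ`) does not vanish on the open simplex, hence `ℚ`-semialgebraic
there. [cite: BCR1998, §2.2] -/
theorem isSemialgebraicFunOn_levelFourRe (m : Fin 5) (j : Fin n) :
    IsSemialgebraicFunOn ℚ (openOrderedSimplex n) (fun t => levelFourRe m (t j)) := by
  have hs := isSemialgebraic_openOrderedSimplex n
  have key : ∀ (p q : MvPolynomial (Fin n) ℚ), (∀ t ∈ openOrderedSimplex n, aeval t q ≠ 0) →
      (∀ t ∈ openOrderedSimplex n, levelFourRe m (t j) = aeval t p / aeval t q) →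
      IsSemialgebraicFunOn ℚ (openOrderedSimplex n) (fun t => levelFourRe m (t j)) :=
    fun p q hq h => (isSemialgebraicFunOn_aeval_div_aeval hs p q hq).congr fun t ht => (h t ht).symm
  fin_cases m
  · refine key 1 (X j - 1) (fun t ht => ?_) (fun t _ => ?_)
    · have := ht.2.1 j; simp [sub_eq_zero, this.ne]
    · show 1 / (t j - 1) = _; simp
  · refine key (X j) (1 + X j ^ 2) (fun t _ => ?_) (fun t _ => ?_)
    · have : (0 : ℝ) < 1 + t j ^ 2 := by positivity
      simpa using this.ne'
    · show t j / (1 + t j ^ 2) = _; simp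
  · refine key 1 (1 + X j) (fun t ht => ?_) (fun t _ => ?_)
    · have := ht.1 j; simp; linarith
    · show 1 / (1 + t j) = _; simp
  · refine key (X j) (1 + X j ^ 2) (fun t _ => ?_) (fun t _ => ?_)
    · have : (0 : ℝ) < 1 + t j ^ 2 := by positivity
      simpa using this.ne'
    · show t j / (1 + t j ^ 2) = _; simp
  · refine key 1 (X j) (fun t ht => ?_) (fun t _ => ?_)
    · have := ht.1 j; simpa using this.ne'
    · show 1 / t j = _; simp

/-- Each imaginary-part letter `t ↦ im_m(tⱼ)` is `ℚ`-semialgebraic on the open simplex.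
[cite: BCR1998, §2.2] -/
theorem isSemialgebraicFunOn_levelFourIm (m : Fin 5) (j : Fin n) :
    IsSemialgebraicFunOn ℚ (openOrderedSimplex n) (fun t => levelFourIm m (t j)) := by
  have hs := isSemialgebraic_openOrderedSimplex n
  have key : ∀ (p q : MvPolynomial (Fin n) ℚ), (∀ t ∈ openOrderedSimplex n, aeval t q ≠ 0) →
      (∀ t ∈ openOrderedSimplex n, levelFourIm m (t j) = aeval t p / aeval t q) →
      IsSemialgebraicFunOn ℚ (openOrderedSimplex n) (fun t => levelFourIm m (t j)) :=
    fun p q hq h => (isSemialgebraicFunOn_aeval_div_aeval hs p q hq).congr fun t ht => (h t ht).symm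
  have hsq : ∀ t : Fin n → ℝ, aeval t (1 + X j ^ 2 : MvPolynomial (Fin n) ℚ) ≠ 0 := fun t => by
    have : (0 : ℝ) < 1 + t j ^ 2 := by positivity
    simpa using this.ne'
  fin_cases m
  · exact key 0 1 (fun t _ => by simp) (fun t _ => by show (0 : ℝ) = _; simp)
  · exact key 1 (1 + X j ^ 2) (fun t _ => hsq t) (fun t _ => by show 1 / (1 + t j ^ 2) = _; simp)
  · exact key 0 1 (fun t _ => by simp) (fun t _ => by show (0 : ℝ) = _; simp)
  · refine key (-1) (1 + X j ^ 2) (fun t _ => hsq t) (fun t _ => ?_)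
    show -1 / (1 + t j ^ 2) = _; simp [neg_div]
  · exact key 0 1 (fun t _ => by simp) (fun t _ => by show (0 : ℝ) = _; simp)

/-- Real and imaginary parts of the partial products `∏_{j ∈ S} (re_{Lⱼ}(tⱼ) + i·im_{Lⱼ}(tⱼ))` are
`ℚ`-semialgebraic on the open simplex: induction on `S` with
`Re(zw) = Re z Re w - Im z Im w`, `Im(zw) = Re z Im w + Im z Re w` and closure of real
semialgebraic functions under `+`, `-`, `·` (BCR Prop. 2.2.6, the tree's
`IsSemialgebraicFunOn.add/sub/mul_holds`). [cite: BCR1998, Prop. 2.2.6] -/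
theorem isSemialgebraicFunOn_re_im_prod (L : Fin n → Fin 5) (S : Finset (Fin n)) :
    IsSemialgebraicFunOn ℚ (openOrderedSimplex n)
        (fun t => (∏ j ∈ S, levelFourFactor (L j) (t j)).re) ∧
      IsSemialgebraicFunOn ℚ (openOrderedSimplex n)
        (fun t => (∏ j ∈ S, levelFourFactor (L j) (t j)).im) := by
  classical
  induction S using Finset.induction_on with
  | empty =>
    constructor
    · simpa using (isSemialgebraicFunOn_aeval (isSemialgebraic_openOrderedSimplex n)
        (1 : MvPolynomial (Fin n) ℚ)).congr fun t _ => by simp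
    · simpa using (isSemialgebraicFunOn_aeval (isSemialgebraic_openOrderedSimplex n)
        (0 : MvPolynomial (Fin n) ℚ)).congr fun t _ => by simp
  | insert a S ha ih =>
    obtain ⟨hre, him⟩ := ih
    have hra := isSemialgebraicFunOn_levelFourRe (n := n) (L a) a
    have hia := isSemialgebraicFunOn_levelFourIm (n := n) (L a) a
    have ere : ∀ t : Fin n → ℝ, (∏ j ∈ insert a S, levelFourFactor (L j) (t j)).re =
        levelFourRe (L a) (t a) * (∏ j ∈ S, levelFourFactor (L j) (t j)).re -
          levelFourIm (L a) (t a) * (∏ j ∈ S, levelFourFactor (L j) (t j)).im := fun t => by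
      rw [Finset.prod_insert ha, Complex.mul_re]
      simp [levelFourFactor]
    have eim : ∀ t : Fin n → ℝ, (∏ j ∈ insert a S, levelFourFactor (L j) (t j)).im =
        levelFourRe (L a) (t a) * (∏ j ∈ S, levelFourFactor (L j) (t j)).im +
          levelFourIm (L a) (t a) * (∏ j ∈ S, levelFourFactor (L j) (t j)).re := fun t => by
      rw [Finset.prod_insert ha, Complex.mul_im]
      simp [levelFourFactor]
    constructor
    · refine (IsSemialgebraicFunOn.sub_holds (IsSemialgebraicFunOn.mul_holds hra hre)
        (IsSemialgebraicFunOn.mul_holds hia him)).congr fun t _ => ?_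
      simp only [Pi.sub_apply, Pi.mul_apply, ere]
    · refine (IsSemialgebraicFunOn.add_holds (IsSemialgebraicFunOn.mul_holds hra him)
        (IsSemialgebraicFunOn.mul_holds hia hre)).congr fun t _ => ?_
      simp only [Pi.add_apply, Pi.mul_apply, eim]

/-- The real part of the tuple integrand is `ℚ`-semialgebraic on the open simplex.
[cite: BCR1998, Prop. 2.2.6] -/
theorem isSemialgebraicFunOn_re_levelFourProd (L : Fin n → Fin 5) :
    IsSemialgebraicFunOn ℚ (openOrderedSimplex n) (fun t => (levelFourProd L t).re) :=
  (isSemialgebraicFunOn_re_im_prod L Finset.univ).1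

/-- The imaginary part of the tuple integrand is `ℚ`-semialgebraic on the open simplex.
[cite: BCR1998, Prop. 2.2.6] -/
theorem isSemialgebraicFunOn_im_levelFourProd (L : Fin n → Fin 5) :
    IsSemialgebraicFunOn ℚ (openOrderedSimplex n) (fun t => (levelFourProd L t).im) :=
  (isSemialgebraicFunOn_re_im_prod L Finset.univ).2

/-- **`levelFourIntegrandRe W` is a `ℚ`-semialgebraic function on the open ordered simplex**
(a rational function with rational coefficients and non-vanishing denominator; KZ's literal
shape). [cite: KontsevichZagier2001, §1.1] -/
theorem isSemialgebraicFunOn_levelFourIntegrandRe (W : List (Fin 5)) :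
    IsSemialgebraicFunOn ℚ (openOrderedSimplex W.length) (levelFourIntegrandRe W) :=
  isSemialgebraicFunOn_re_levelFourProd W.get

/-- **`levelFourIntegrandIm W` is a `ℚ`-semialgebraic function on the open ordered simplex.**
[cite: KontsevichZagier2001, §1.1] -/
theorem isSemialgebraicFunOn_levelFourIntegrandIm (W : List (Fin 5)) :
    IsSemialgebraicFunOn ℚ (openOrderedSimplex W.length) (levelFourIntegrandIm W) :=
  isSemialgebraicFunOn_im_levelFourProd W.get

/-! ### Measurability -/

/-- The real-part letters are measurable functions on `ℝ`. [folklore] -/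
theorem measurable_levelFourRe (m : Fin 5) : Measurable (levelFourRe m) := by
  fin_cases m
  · show Measurable (fun t : ℝ => 1 / (t - 1)); fun_prop
  · show Measurable (fun t : ℝ => t / (1 + t ^ 2)); fun_prop
  · show Measurable (fun t : ℝ => 1 / (1 + t)); fun_prop
  · show Measurable (fun t : ℝ => t / (1 + t ^ 2)); fun_prop
  · show Measurable (fun t : ℝ => 1 / t); fun_prop

/-- The imaginary-part letters are measurable functions on `ℝ`. [folklore] -/
theorem measurable_levelFourIm (m : Fin 5) : Measurable (levelFourIm m) := by
  fin_cases m
  · show Measurable (fun _ : ℝ => (0 : ℝ)); fun_prop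
  · show Measurable (fun t : ℝ => 1 / (1 + t ^ 2)); fun_prop
  · show Measurable (fun _ : ℝ => (0 : ℝ)); fun_prop
  · show Measurable (fun t : ℝ => -1 / (1 + t ^ 2)); fun_prop
  · show Measurable (fun _ : ℝ => (0 : ℝ)); fun_prop

/-- The complex letters are measurable. [folklore] -/
theorem measurable_levelFourFactor (m : Fin 5) : Measurable (levelFourFactor m) :=
  (Complex.measurable_ofReal.comp (measurable_levelFourRe m)).add
    ((Complex.measurable_ofReal.comp (measurable_levelFourIm m)).mul_const I)

/-- The tuple integrand is measurable on `ℝⁿ`. [folklore] -/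
theorem measurable_levelFourProd (L : Fin n → Fin 5) : Measurable (levelFourProd L) :=
  Finset.measurable_prod _ fun j _ =>
    (measurable_levelFourFactor (L j)).comp (measurable_pi_apply j)

/-- The complex integrand of a word is measurable. [folklore] -/
theorem measurable_levelFourIntegrandC (W : List (Fin 5)) :
    Measurable (levelFourIntegrandC W) :=
  measurable_levelFourProd W.get

/-- The real-part integrand of a word is measurable. [folklore] -/
theorem measurable_levelFourIntegrandRe (W : List (Fin 5)) :
    Measurable (levelFourIntegrandRe W) :=
  Complex.measurable_re.comp (measurable_levelFourIntegrandC W)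

/-- The imaginary-part integrand of a word is measurable. [folklore] -/
theorem measurable_levelFourIntegrandIm (W : List (Fin 5)) :
    Measurable (levelFourIntegrandIm W) :=
  Complex.measurable_im.comp (measurable_levelFourIntegrandC W)

/-! ### Pointwise bounds on `(0, 1)` -/

/-- **Letter bound.** For `0 < t < 1`: `|1/(t - 1)| = (1-t)⁻¹`, `|1/(t ∓ i)| ≤ 1`,
`|1/(t + 1)| ≤ 1`, `|1/t| = t⁻¹`; uniformly,
`‖letter_m(t)‖ ≤ (if m = 0 then (1-t)⁻¹ else 1) · (if m = 4 then t⁻¹ else 1)`. [folklore] -/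
theorem norm_levelFourFactor_le (m : Fin 5) {t : ℝ} (h0 : 0 < t) (h1 : t < 1) :
    ‖levelFourFactor m t‖ ≤ (if m = 0 then (1 - t)⁻¹ else 1) * (if m = 4 then t⁻¹ else 1) := by
  rw [levelFourFactor_eq, norm_inv]
  fin_cases m
  · show ‖(t : ℂ) - 1‖⁻¹ ≤
      (if (0 : Fin 5) = 0 then (1 - t)⁻¹ else 1) * (if (0 : Fin 5) = 4 then t⁻¹ else 1)
    rw [if_pos rfl, if_neg (by decide), mul_one, show (t : ℂ) - 1 = ((t - 1 : ℝ) : ℂ) by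
      push_cast; ring, Complex.norm_real, Real.norm_eq_abs, abs_of_neg (by linarith), neg_sub]
  · show ‖(t : ℂ) - I‖⁻¹ ≤
      (if (1 : Fin 5) = 0 then (1 - t)⁻¹ else 1) * (if (1 : Fin 5) = 4 then t⁻¹ else 1)
    rw [if_neg (by decide), if_neg (by decide), mul_one]
    refine inv_le_one_of_one_le₀ ?_
    have := Complex.abs_im_le_norm ((t : ℂ) - I)
    simpa using this
  · show ‖(t : ℂ) - -1‖⁻¹ ≤
      (if (2 : Fin 5) = 0 then (1 - t)⁻¹ else 1) * (if (2 : Fin 5) = 4 then t⁻¹ else 1)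
    rw [if_neg (by decide), if_neg (by decide), mul_one, sub_neg_eq_add,
      show (t : ℂ) + 1 = ((t + 1 : ℝ) : ℂ) by push_cast; ring, Complex.norm_real, Real.norm_eq_abs,
      abs_of_pos (by linarith)]
    exact inv_le_one_of_one_le₀ (by linarith)
  · show ‖(t : ℂ) - -I‖⁻¹ ≤
      (if (3 : Fin 5) = 0 then (1 - t)⁻¹ else 1) * (if (3 : Fin 5) = 4 then t⁻¹ else 1)
    rw [if_neg (by decide), if_neg (by decide), mul_one]
    refine inv_le_one_of_one_le₀ ?_
    have := Complex.abs_im_le_norm ((t : ℂ) - -I)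
    simpa using this
  · show ‖(t : ℂ) - 0‖⁻¹ ≤
      (if (4 : Fin 5) = 0 then (1 - t)⁻¹ else 1) * (if (4 : Fin 5) = 4 then t⁻¹ else 1)
    rw [if_neg (by decide), if_pos rfl, one_mul, sub_zero, Complex.norm_real, Real.norm_eq_abs,
      abs_of_pos h0]

/-- **Product bound on the simplex**: `‖∏ⱼ (tⱼ - pole Lⱼ)⁻¹‖ ≤ ∏_{Lⱼ = pole 1} (1 - tⱼ)⁻¹ ·
∏_{Lⱼ = pole 0} tⱼ⁻¹` (the complex letters `±i`, `-1` have modulus `≤ 1`). [folklore] -/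
theorem norm_levelFourProd_le (L : Fin n → Fin 5) {t : Fin n → ℝ} (ht : t ∈ openOrderedSimplex n) :
    ‖levelFourProd L t‖ ≤
      (∏ i ∈ Finset.univ.filter (fun i => L i = 0), (1 - t i)⁻¹) *
        ∏ i ∈ Finset.univ.filter (fun i => L i = 4), (t i)⁻¹ := by
  obtain ⟨ht0, ht1, -⟩ := ht
  rw [levelFourProd, norm_prod, Finset.prod_filter, Finset.prod_filter, ← Finset.prod_mul_distrib]
  refine Finset.prod_le_prod (fun i _ => norm_nonneg _) fun i _ => ?_
  exact norm_levelFourFactor_le (L i) (ht0 i) (ht1 i)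

/-! ### Absolute convergence on the open ordered simplex -/

/-- **Domination lemma** (generic form of the argument of `KZ.integrableOn_prod_mzvForm`): a
measurable function on the open ordered simplex `1 > t₀ > ⋯ > t_k > 0` bounded by
`∏_{i ∈ O} (1 - tᵢ)⁻¹ · ∏_{i ∈ Z} tᵢ⁻¹` with `0 ∉ O` and `k ∉ Z` is absolutely integrable: since
`1 - t₀` (resp. `t_k`) is the smallest of the `1 - tᵢ` (resp. `tᵢ`), `KZ.prod_inv_le_prod_rpow`
gives domination by `∏ᵢ (1 - tᵢ)^{-c} tᵢ^{-c} ≤ ∏ᵢ 2(tᵢ^{-c} + (1 - tᵢ)^{-c})`, `c = k/(k+1) < 1`,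
a product of one-variable functions integrable on `(0,1)` (Fubini). [cite: Zagier1994, §9] -/
theorem integrableOn_openOrderedSimplex_of_norm_le {E : Type*} [NormedAddCommGroup E] {k : ℕ}
    (F : (Fin (k + 1) → ℝ) → E)
    (hF : AEStronglyMeasurable F (volume.restrict (openOrderedSimplex (k + 1))))
    (O Z : Finset (Fin (k + 1))) (hO : (0 : Fin (k + 1)) ∉ O) (hZ : Fin.last k ∉ Z)
    (hle : ∀ t ∈ openOrderedSimplex (k + 1),
      ‖F t‖ ≤ (∏ i ∈ O, (1 - t i)⁻¹) * ∏ i ∈ Z, (t i)⁻¹) :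
    IntegrableOn F (openOrderedSimplex (k + 1)) volume := by
  -- the exponent `c = k / (k + 1) = 1 - 1/(k+1)`
  set c : ℝ := k / (k + 1) with hc_def
  have hk : (0 : ℝ) < k + 1 := by positivity
  have hc0 : 0 ≤ c := by positivity
  have hc1 : c < 1 := by rw [hc_def, div_lt_one hk]; linarith
  have h1c : 1 - c = 1 / (k + 1) := by rw [hc_def, one_sub_div hk.ne']; ring
  have hcard : ∀ (S : Finset (Fin (k + 1))) (j : Fin (k + 1)), j ∉ S →
      (S.card : ℝ) * (1 - c) ≤ c := by
    intro S j hj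
    have hS : S ≠ Finset.univ := fun h => hj (h ▸ Finset.mem_univ j)
    have hlt : S.card < k + 1 := by
      simpa using Finset.card_lt_card (Finset.ssubset_univ_iff.mpr hS)
    have hle' : (S.card : ℝ) ≤ k := by exact_mod_cast Nat.lt_succ_iff.mp hlt
    calc (S.card : ℝ) * (1 - c) ≤ k * (1 - c) := mul_le_mul_of_nonneg_right hle' (by linarith)
      _ = c := by rw [h1c, hc_def]; ring
  -- the dominating function: a product of one-variable integrable functions
  have hg : Integrable (fun t : Fin (k + 1) → ℝ =>
      ∏ i, (Ioo (0 : ℝ) 1).indicator (fun x : ℝ => 2 * (x ^ (-c) + (1 - x) ^ (-c))) (t i))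
      (volume : Measure (Fin (k + 1) → ℝ)) := by
    have hφ : Integrable
        ((Ioo (0 : ℝ) 1).indicator fun x : ℝ => 2 * (x ^ (-c) + (1 - x) ^ (-c))) volume :=
      (integrableOn_Ioo_majorant hc1).integrable_indicator measurableSet_Ioo
    exact Integrable.fintype_prod (μ := fun _ : Fin (k + 1) => (volume : Measure ℝ))
      (f := fun _ => (Ioo (0 : ℝ) 1).indicator fun x : ℝ => 2 * (x ^ (-c) + (1 - x) ^ (-c)))
      fun _ => hφ
  refine Integrable.mono' hg.integrableOn hF
    ((ae_restrict_mem (measurableSet_openOrderedSimplex _)).mono fun t ht => ?_)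
  have hle_t := hle t ht
  obtain ⟨ht0, ht1, hanti⟩ := ht
  have hO' : ∏ i ∈ O, (1 - t i)⁻¹ ≤ ∏ i, (1 - t i) ^ (-c) :=
    prod_inv_le_prod_rpow O (fun i : Fin (k + 1) => 1 - t i) (0 : Fin (k + 1)) hO
      (fun i => by linarith [ht1 i]) (fun i => by linarith [ht0 i])
      (fun i => by linarith [hanti.antitone (Fin.zero_le i)]) hc0 hc1.le (hcard O 0 hO)
  have hZ' : ∏ i ∈ Z, (t i)⁻¹ ≤ ∏ i, t i ^ (-c) :=
    prod_inv_le_prod_rpow Z t (Fin.last k) hZ ht0 (fun i => (ht1 i).le)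
      (fun i => hanti.antitone (Fin.le_last i)) hc0 hc1.le (hcard Z (Fin.last k) hZ)
  calc ‖F t‖ ≤ (∏ i ∈ O, (1 - t i)⁻¹) * ∏ i ∈ Z, (t i)⁻¹ := hle_t
    _ ≤ (∏ i, (1 - t i) ^ (-c)) * ∏ i, t i ^ (-c) :=
        mul_le_mul hO' hZ' (Finset.prod_nonneg fun i _ => (inv_pos.2 (ht0 i)).le)
          (Finset.prod_nonneg fun i _ => Real.rpow_nonneg (by linarith [ht1 i]) _)
    _ = ∏ i, t i ^ (-c) * (1 - t i) ^ (-c) := by rw [Finset.prod_mul_distrib, mul_comm]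
    _ ≤ ∏ i, 2 * (t i ^ (-c) + (1 - t i) ^ (-c)) :=
        Finset.prod_le_prod (fun i _ => mul_nonneg (Real.rpow_nonneg (ht0 i).le _)
          (Real.rpow_nonneg (by linarith [ht1 i]) _))
          fun i _ => rpow_neg_mul_one_sub_rpow_neg_le hc0 hc1.le (ht0 i) (ht1 i)
    _ = ∏ i, (Ioo (0 : ℝ) 1).indicator (fun x : ℝ => 2 * (x ^ (-c) + (1 - x) ^ (-c))) (t i) :=
        Finset.prod_congr rfl fun i _ => (Set.indicator_of_mem (Set.mem_Ioo.2 ⟨ht0 i, ht1 i⟩)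
          (fun x : ℝ => 2 * (x ^ (-c) + (1 - x) ^ (-c)))).symm

/-- **Absolute convergence, tuple form**: if the first letter is not the pole `1` and the last
letter is not the pole `0`, the integrand `∏ⱼ (tⱼ - pole Lⱼ)⁻¹` is absolutely integrable on the
open ordered simplex (`n = 0`: a constant on a point). [cite: Zhao2010, §2] -/
theorem integrableOn_levelFourProd (L : Fin n → Fin 5)
    (hfirst : ∀ h : 0 < n, L ⟨0, h⟩ ≠ 0)
    (hlast : ∀ h : 0 < n, L ⟨n - 1, Nat.sub_one_lt_of_lt h⟩ ≠ 4) :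
    IntegrableOn (levelFourProd L) (openOrderedSimplex n) volume := by
  rcases Nat.eq_zero_or_pos n with rfl | hn
  · have : IsFiniteMeasure (volume : Measure (Fin 0 → ℝ)) := by
      rw [volume_pi, Measure.pi_of_empty]; infer_instance
    have h1 : levelFourProd L = fun _ => 1 := funext fun t => by simp [levelFourProd]
    rw [h1]
    exact integrableOn_const
  obtain ⟨k, rfl⟩ : ∃ k, n = k + 1 := ⟨n - 1, by omega⟩
  refine integrableOn_openOrderedSimplex_of_norm_le (levelFourProd L)
    (measurable_levelFourProd L).aestronglyMeasurable
    (Finset.univ.filter fun i => L i = 0) (Finset.univ.filter fun i => L i = 4) ?_ ?_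
    fun t ht => norm_levelFourProd_le L ht
  · simpa using hfirst hn
  · have : L (Fin.last k) ≠ 4 := by
      convert hlast hn using 2
      exact Fin.ext (by simp)
    simpa using this

/-- **Absolute convergence, tuple form in positive dimension**: first letter `≠` pole `1`, last
letter `≠` pole `0`. [cite: Zhao2010, §2] -/
theorem integrableOn_levelFourProd_succ {k : ℕ} (L : Fin (k + 1) → Fin 5) (hfirst : L 0 ≠ 0)
    (hlast : L (Fin.last k) ≠ 4) :
    IntegrableOn (levelFourProd L) (openOrderedSimplex (k + 1)) volume :=
  integrableOn_levelFourProd L (fun _ => hfirst) fun _ => by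
    convert hlast using 2
    exact Fin.ext (by simp)

/-- **Absolute convergence for convergent words**: for a word whose first letter is not the pole
`1` and whose last letter is not the pole `0`, `∏ⱼ (tⱼ - pole Wⱼ)⁻¹` is absolutely integrable on
`1 > t₀ > ⋯ > t_{n-1} > 0` (domination as in `KZ.mzvIntegrand_integrableOn_holds`).
[cite: Zhao2010, §2] -/
theorem integrableOn_levelFourIntegrandC {W : List (Fin 5)} (hW : LevelFour.IsConvergent W) :
    IntegrableOn (levelFourIntegrandC W) (openOrderedSimplex W.length) volume := by
  refine integrableOn_levelFourProd W.get (fun h h0 => hW.1 ?_) (fun h h4 => hW.2 ?_)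
  · cases W with
    | nil => simp at h
    | cons a W => simpa using h0
  · rw [List.getLast?_eq_getElem?, List.getElem?_eq_getElem (by omega)]
    simpa [List.get_eq_getElem] using h4

/-- The real-part integrand is absolutely integrable when the complex integrand is
(`|Re z| ≤ ‖z‖`). [folklore] -/
theorem integrableOn_levelFourIntegrandRe {W : List (Fin 5)}
    (h : IntegrableOn (levelFourIntegrandC W) (openOrderedSimplex W.length) volume) :
    IntegrableOn (levelFourIntegrandRe W) (openOrderedSimplex W.length) volume :=
  Integrable.mono' h.norm (measurable_levelFourIntegrandRe W).aestronglyMeasurable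
    (Filter.Eventually.of_forall fun t => by
      rw [Real.norm_eq_abs]; exact Complex.abs_re_le_norm _)

/-- The imaginary-part integrand is absolutely integrable when the complex integrand is
(`|Im z| ≤ ‖z‖`). [folklore] -/
theorem integrableOn_levelFourIntegrandIm {W : List (Fin 5)}
    (h : IntegrableOn (levelFourIntegrandC W) (openOrderedSimplex W.length) volume) :
    IntegrableOn (levelFourIntegrandIm W) (openOrderedSimplex W.length) volume :=
  Integrable.mono' h.norm (measurable_levelFourIntegrandIm W).aestronglyMeasurable
    (Filter.Eventually.of_forall fun t => by
      rw [Real.norm_eq_abs]; exact Complex.abs_im_le_norm _)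

/-! ### The representations -/

/-- **`levelFourRepRe W hconv`**: the rational simplex representation of `Re I(W)` — domain the
open ordered simplex `1 > t₀ > ⋯ > t_{|W|-1} > 0` (`ℚ`-semialgebraic), integrand
`levelFourIntegrandRe W` (`ℚ`-semialgebraic, proved), absolutely convergent by the hypothesis
`hconv` on the complex integrand (feed `integrableOn_levelFourIntegrandC hW` for a convergent
word). [cite: KontsevichZagier2001, §1.1] -/
def levelFourRepRe (W : List (Fin 5))
    (hconv : IntegrableOn (levelFourIntegrandC W) (openOrderedSimplex W.length) volume) :
    IntegralRep W.length where
  domain := openOrderedSimplex W.length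
  integrand := levelFourIntegrandRe W
  isSemialgebraic_domain := isSemialgebraic_openOrderedSimplex _
  isSemialgebraicFunOn_integrand := isSemialgebraicFunOn_levelFourIntegrandRe W
  integrableOn := integrableOn_levelFourIntegrandRe hconv

/-- **`levelFourRepIm W hconv`**: the rational simplex representation of `Im I(W)` (same domain,
integrand `levelFourIntegrandIm W`). [cite: KontsevichZagier2001, §1.1] -/
def levelFourRepIm (W : List (Fin 5))
    (hconv : IntegrableOn (levelFourIntegrandC W) (openOrderedSimplex W.length) volume) :
    IntegralRep W.length where
  domain := openOrderedSimplex W.length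
  integrand := levelFourIntegrandIm W
  isSemialgebraic_domain := isSemialgebraic_openOrderedSimplex _
  isSemialgebraicFunOn_integrand := isSemialgebraicFunOn_levelFourIntegrandIm W
  integrableOn := integrableOn_levelFourIntegrandIm hconv

/-- The domain of `levelFourRepRe`, unfolded. [folklore] -/
@[simp] theorem levelFourRepRe_domain (W : List (Fin 5)) (h) :
    (levelFourRepRe W h).domain = openOrderedSimplex W.length := rfl

/-- The domain of `levelFourRepIm`, unfolded. [folklore] -/
@[simp] theorem levelFourRepIm_domain (W : List (Fin 5)) (h) :
    (levelFourRepIm W h).domain = openOrderedSimplex W.length := rfl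

/-- The integrand of `levelFourRepRe`, unfolded. [folklore] -/
@[simp] theorem levelFourRepRe_integrand (W : List (Fin 5)) (h) :
    (levelFourRepRe W h).integrand = levelFourIntegrandRe W := rfl

/-- The integrand of `levelFourRepIm`, unfolded. [folklore] -/
@[simp] theorem levelFourRepIm_integrand (W : List (Fin 5)) (h) :
    (levelFourRepIm W h).integrand = levelFourIntegrandIm W := rfl

/-- **The value of `levelFourRepRe W` is `Re ∫_Δ ∏ⱼ (tⱼ - pole Wⱼ)⁻¹ dt = Re I(W)`** (the real
part commutes with the Bochner integral of the integrable complex integrand). [folklore] -/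
theorem levelFourRepRe_value (W : List (Fin 5)) (h) :
    (levelFourRepRe W h).value =
      (∫ t in openOrderedSimplex W.length, levelFourIntegrandC W t).re := by
  have := Complex.reCLM.integral_comp_comm h
  simp only [Complex.reCLM_apply] at this
  exact this

/-- **The value of `levelFourRepIm W` is `Im I(W)`.** [folklore] -/
theorem levelFourRepIm_value (W : List (Fin 5)) (h) :
    (levelFourRepIm W h).value =
      (∫ t in openOrderedSimplex W.length, levelFourIntegrandC W t).im := by
  have := Complex.imCLM.integral_comp_comm h
  simp only [Complex.imCLM_apply] at this
  exact this

/-- `I(W) = value(levelFourRepRe W) + i · value(levelFourRepIm W)`. [folklore] -/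
theorem integral_levelFourIntegrandC_eq (W : List (Fin 5)) (h) :
    ∫ t in openOrderedSimplex W.length, levelFourIntegrandC W t =
      ((levelFourRepRe W h).value : ℂ) + ((levelFourRepIm W h).value : ℂ) * I := by
  rw [levelFourRepRe_value, levelFourRepIm_value]
  exact (Complex.re_add_im _).symm

/-- **Fact (value of the level-4 simplex representations = the MPV).** For a convergent index
`k = ((s₁,e₁),…,(s_ℓ,e_ℓ))` (`(s₁, i^{e₁}) ≠ (1, 1)`) the nested partial sums
`∑_{N > n₁ > ⋯ > n_ℓ ≥ 1} ∏ⱼ i^{eⱼnⱼ}/nⱼ^{sⱼ}` of `Li_{s₁,…,s_ℓ}(i^{e₁},…,i^{e_ℓ})` converge, as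
`N → ∞`, to `(-1)^ℓ ∫_{1 > t₀ > ⋯ > 0} ∏ⱼ dtⱼ/(tⱼ - aⱼ')` over the word
`0^{s₁-1}a₁ ⋯ 0^{s_ℓ-1}a_ℓ`, `aⱼ = (x₁⋯xⱼ)⁻¹` — Zhao 2010, §1 eqs. (1)–(2) and §2
("if `(s₁, μ^{i₁}) ≠ (1,1)` then `L_N(s|i) = ∫₀¹ y_{s₁,i₁} y_{s₂,i₁+i₂} ⋯`"); hence
`Li = (-1)^ℓ (value(levelFourRepRe (word k)) + i·value(levelFourRepIm (word k)))` by
`integral_levelFourIntegrandC_eq`. (For `s₁ = 1` the series converges only conditionally, which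
is why the limit of nested partial sums, not a `tsum`, is asserted.) [cite: Zhao2010, §1 eq. (2)] -/
def levelFourRep_value : Prop :=
  ∀ k : List (ℕ × Fin 4), LevelFour.IsConvergentIdx k →
    Tendsto (LevelFour.polylogTrunc k) atTop
      (nhds ((-1 : ℂ) ^ k.length *
        ∫ t in openOrderedSimplex (LevelFour.word k).length,
          levelFourIntegrandC (LevelFour.word k) t))

/-- Non-vacuity: the representation of `Re I(i) = Re log(1 - i)⁻¹…` — the word `(i)` is convergent
and the point `1/2` lies in its domain `(0, 1)`. [folklore] -/
example : (fun _ => (1 / 2 : ℝ)) ∈ (levelFourRepRe [1]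
    (integrableOn_levelFourIntegrandC (by decide))).domain := by
  refine ⟨fun _ => by norm_num, fun _ => by norm_num, fun i j hij => absurd (Fin.lt_def.mp hij) ?_⟩
  have hi := i.isLt
  have hj := j.isLt
  simp only [List.length_cons, List.length_nil] at hi hj
  omega

end KZ

end Literature.NumberTheory.Transcendental
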